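import Summits.QuantumFields.BalabanUV.T4Continuum.Support.WeightRouteEnd

/-!
# `T4Continuum.Support.RemnantOldComposition` — node U5 (NE7), road P3-W «weight route», leaf R.1.C: the OLD side of
NE7b-rem COMPOSED on abstract carriers — banked sub-history bound (S1-shape) ⇒ marked operator mass (S3) ⇒ marked
activity (S4) ⇒ marked exponentiation (S5-shape) ⇒ anchored count (S6-shape) ⇒ `RemnantAgeBound`

(cell `pub-balaban`, BINDER-OWNERS row NE7 co-owner #3 `b2b-balaban-t4-ne7-p3`, ROUND-2 skeleton
`t4/skeletons/NE7-t4-ne7-p3.md` §2 R.1 / §4 stub (s5); kernel bookkeeping over ABSTRACT data; imports the road's END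
module `Support/WeightRouteEnd.lean` (p206830) only.)

HONEST FRAMING (T4-DAG PAGE 1).  Fixed finite T⁴, rung (B)+1, CONDITIONAL on BetaPertH and the nine spine estimates
(0/9 proved); NOT infinite volume, NOT the mass gap, NOT the Clay problem.  This module proves NO estimate of
Bałaban's.  It is the ARITHMETIC SPINE of the cell record `t4/T4-EST-U5E-rem.md` §3 (retired surge seat pv25; NE7b-rem
is NOT PRINTED — [Balaban1989LargeFieldII] (1.89)/(1.92)/(1.99)/(1.100) pp. 387–390 are the bank-free case), typed over
abstract finite data so that each analytic input is a displayed BINDER: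
* (S1-shape) `hbank`: along every sub-history `h` of an operator slot, weight × count ≤ `e^{−bank h}·M₀` — the output
  of the banked induction (1.80⁺) (kernel on the model: `T4BankedInduction.banked_induction`, row NE7b's engine);
* (S3) PROVED in `WeightRouteEnd` (`sum_filter_bank_le`): the old-bank marked mass of a slot is `≤ e^{−Bk}·M₀`;
* (S4) PROVED in `WeightRouteEnd` (`prod_add_sub_prod_le_card_mul`) and HERE at activity level (§1
  `markedActivity_le`): an activity = a finite sum of terms, each a product over its operator slots of
  (unmarked + marked mass) times a bounded rest factor; its marked part is `≤ e^{−Bk} ·` (the marked majorant);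
* (S5-shape) `hexp : MarkedExponentiationBound locR profile c` (`WeightRouteEnd`; the anchored two-family Lipschitz
  bound of the exponentiated series in its activities — swarm stub (s3) over the tree's Kotecký–Preiss layer);
* (S6-shape) `hcnt : AnchoredCount through dk κ Cκ` (`WeightRouteEnd`; lattice-animal count — swarm stub (s4));
and concludes (§3 `remnantAgeBound_of_marked`) `RemnantAgeBound remOld E₀ ρ` with `ρ = e^{−c_e p̄₀}` for the per-cube
two-run discrepancy `remOld j A := 2 · sup_□ Σ_{X ∋ □} |locR wF X − locR wL X|` at bank cut `Bk = c_e p̄₀ · A` —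
literally the binder `hRem` of the road's END `WeightRoute.hybridNE7_closure'_tail_remnantW`.  Identifications of the
abstract data with print's objects ((1.71) summands, (1.91) slots, (1.98) localization) are the cell's READINGS
(`t4/T4-EST-U5E-rem.md` §2 D1–D3, `…-rem-ident.md`), NOT asserted here.
HONEST DEPENDENCY: continuum YM on T⁴ ⇐ BetaPertH ∧ nine spine estimates (0/9 proved); BetaPertH ⇐ (D1) ∧ (D4) ∧
CAP+tail; G-an2-4 gates asym, D1 and NE2/3/4.
-/

open Finset

namespace Summit.QuantumFields.BalabanUV.T4Continuum.WeightRoute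

open Literature.MathematicalPhysics.QuantumFieldTheory.Balaban1983to89
open Literature.MathematicalPhysics.QuantumFieldTheory.Balaban1983to89.T4RemnantBooking

/-! ## §1 (S4) at activity level: the marked part of a finite sum of slot-products with bounded rest factors -/

section Activity

variable {T S : Type*} [DecidableEq S]

/-- **MARKED ACTIVITY BOUND (S4 at activity level).**  An activity is `F = Σ_{terms} (∏_{slots} (lo + hi)) · rest`,
its unmarked version `F_< = Σ_{terms} (∏_{slots} lo) · rest` (every operator slot restricted to the small-bank
sub-histories); slot masses are nonnegative with `hi ≤ e^{−Bk}·M` (S3) and `lo + hi ≤ M` (the unmarked bound, e.g.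
(1.89)); rest factors obey `|rest| ≤ rb`.  Then `|F − F_<| ≤ e^{−Bk} · Σ_{terms} #slots · M^{#slots} · rb` — the marked
majorant, whose resummation over terms is print's (1.95)/(1.96) with `q` absorbed.  HYPOTHESIS-FREE real analysis.
[folklore] -/
theorem markedActivity_le (terms : Finset T) (slots : T → Finset S) {lo hi : T → S → ℝ} {rest : T → ℝ}
    {M Bk : ℝ} {rb : T → ℝ} (hM : 0 ≤ M)
    (hlo : ∀ τ ∈ terms, ∀ i ∈ slots τ, 0 ≤ lo τ i) (hhi : ∀ τ ∈ terms, ∀ i ∈ slots τ, 0 ≤ hi τ i)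
    (hmark : ∀ τ ∈ terms, ∀ i ∈ slots τ, hi τ i ≤ Real.exp (-Bk) * M)
    (hall : ∀ τ ∈ terms, ∀ i ∈ slots τ, lo τ i + hi τ i ≤ M)
    (hrest : ∀ τ ∈ terms, |rest τ| ≤ rb τ) :
    |(∑ τ ∈ terms, (∏ i ∈ slots τ, (lo τ i + hi τ i)) * rest τ) -
      ∑ τ ∈ terms, (∏ i ∈ slots τ, lo τ i) * rest τ| ≤
      Real.exp (-Bk) * ∑ τ ∈ terms, (slots τ).card * M ^ (slots τ).card * rb τ := by
  rw [← Finset.sum_sub_distrib, Finset.mul_sum]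
  refine (Finset.abs_sum_le_sum_abs _ _).trans (Finset.sum_le_sum fun τ hτ => ?_)
  have hdiff : 0 ≤ ∏ i ∈ slots τ, (lo τ i + hi τ i) - ∏ i ∈ slots τ, lo τ i := by
    rw [sub_nonneg]
    exact Finset.prod_le_prod (fun i hi' => hlo τ hτ i hi')
      (fun i hi' => le_add_of_nonneg_right (hhi τ hτ i hi'))
  have hS4 := prod_add_sub_prod_le_card_mul (slots τ) hM (hlo τ hτ) (hhi τ hτ) (hmark τ hτ) (hall τ hτ)
  rw [← sub_mul, abs_mul, abs_of_nonneg hdiff]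
  have hrb : 0 ≤ rb τ := (abs_nonneg _).trans (hrest τ hτ)
  calc (∏ i ∈ slots τ, (lo τ i + hi τ i) - ∏ i ∈ slots τ, lo τ i) * |rest τ|
      ≤ ((slots τ).card * (Real.exp (-Bk) * M ^ (slots τ).card)) * rb τ :=
        mul_le_mul hS4 (hrest τ hτ) (abs_nonneg _) ((hdiff.trans hS4))
    _ = Real.exp (-Bk) * ((slots τ).card * M ^ (slots τ).card * rb τ) := by ring

end Activity

/-! ## §2 (S3) packaged per slot: the old-bank marked mass from the banked sub-history bound -/

section Slot

variable {H : Type*}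

/-- (S1-shape ⇒ S3, per operator slot.)  If the sub-histories of a slot carry nonnegative weights `w`, positive count
factors `cnt` with `Σ cnt⁻¹ ≤ 1` (print's entropy device, [Balaban1989LargeFieldII] p. 383) and the BANKED bound
`w h · cnt h ≤ e^{−bank h} · M₀` (S1-shape), then the marked mass `hi := Σ_{bank ≥ Bk} w` and the unmarked mass
`lo := Σ_{bank < Bk} w` satisfy `0 ≤ lo`, `0 ≤ hi`, `hi ≤ e^{−Bk}·M₀`, `lo + hi ≤ M₀` — the four slot hypotheses of
`markedActivity_le` with `M = M₀`.  (`WeightRoute.sum_filter_bank_le`, `sum_le_of_mul_cnt_le`.) [folklore] -/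
theorem slot_masses_of_bank (s : Finset H) {w cnt bank : H → ℝ} {M₀ Bk : ℝ} (hM : 0 ≤ M₀)
    (hw0 : ∀ h ∈ s, 0 ≤ w h) (hcnt : ∀ h ∈ s, 0 < cnt h) (hdev : ∑ h ∈ s, (cnt h)⁻¹ ≤ 1)
    (hbank : ∀ h ∈ s, w h * cnt h ≤ Real.exp (-bank h) * M₀) (hbank0 : ∀ h ∈ s, 0 ≤ bank h) :
    0 ≤ ∑ h ∈ s with ¬ Bk ≤ bank h, w h ∧ 0 ≤ ∑ h ∈ s with Bk ≤ bank h, w h ∧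
      ∑ h ∈ s with Bk ≤ bank h, w h ≤ Real.exp (-Bk) * M₀ ∧
      ∑ h ∈ s with ¬ Bk ≤ bank h, w h + ∑ h ∈ s with Bk ≤ bank h, w h ≤ M₀ := by
  refine ⟨Finset.sum_nonneg fun h hh => hw0 h (Finset.mem_filter.mp hh).1,
    Finset.sum_nonneg fun h hh => hw0 h (Finset.mem_filter.mp hh).1,
    sum_filter_bank_le s hM hcnt hdev hbank, ?_⟩
  rw [add_comm, Finset.sum_filter_add_sum_filter_not]
  refine sum_le_of_mul_cnt_le s hM hcnt hdev fun h hh => (hbank h hh).trans ?_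
  exact mul_le_of_le_one_left hM (Real.exp_le_one_iff.mpr (by linarith [hbank0 h hh]))

end Slot

/-! ## §3 (S5-shape) + (S6-shape) ⇒ `RemnantAgeBound` for the per-cube two-run discrepancy -/

section Compose

variable {X P Q : Type*}

/-- **THE OLD SIDE OF NE7b-rem, COMPOSED** (record §3 S5 + S6 ⇒ §0 (b), on abstract carriers).  Data per scale `j`:
two activity families `wF j` (all sub-histories) and `wL j A` (sub-histories of bank `≥ c_e·p̄₀·A` switched off) with
common profile `pr j` and the marked bound `|wF − wL| ≤ 2e^{−c_e p̄₀ A}·pr` (the output of §1/§2, `hmarked`), a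
localized exponentiation `locR` with Lipschitz modulus `c ≥ 0` along a decay profile `e^{−κ dk}` (S5-shape `hexp`),
and the anchored count `Σ_{X ∋ □} e^{−κ dk X} ≤ Cκ` (S6-shape `hcnt`).  Then the per-cube two-run discrepancy
`remOld j A := 2 · sup_□ Σ_{X ∋ □} |locR (wF j) X − locR (wL j A) X|` (the factor 2: each run's old-bank remnant is
bounded by the one-run size, record §0 (b)) obeys `RemnantAgeBound remOld (2·c·Cκ) (e^{−c_e p̄₀})` — the binder `hRem`
of `hybridNE7_closure'_tail_remnantW`, for ALL `A`, uniformly in `j`.  CONDITIONAL on the displayed shapes; nothing of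
Bałaban's is asserted. [folklore] -/
theorem remnantAgeBound_of_marked [Fintype Q] [Nonempty Q] (through : Q → Finset X) (dk : X → ℝ) {κ Cκ c ce p₀ : ℝ}
    (locR : (P → ℝ) → X → ℝ) (wF : ℕ → P → ℝ) (wL : ℕ → ℕ → P → ℝ) (pr : ℕ → P → ℝ)
    (hc : 0 ≤ c) (hce : 0 ≤ ce * p₀)
    (hexp : MarkedExponentiationBound locR (fun x => Real.exp (-(κ * dk x))) c)
    (hcnt : AnchoredCount through dk κ Cκ)
    (hF : ∀ j p, |wF j p| ≤ pr j p) (hL : ∀ j A p, |wL j A p| ≤ pr j p)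
    (hmarked : ∀ j A p, |wF j p - wL j A p| ≤ 2 * Real.exp (-(ce * p₀ * A)) * pr j p) :
    RemnantAgeBound
      (fun j A => 2 * Finset.univ.sup' Finset.univ_nonempty
        (fun q => ∑ x ∈ through q, |locR (wF j) x - locR (wL j A) x|))
      (2 * c * Cκ) (Real.exp (-(ce * p₀))) := by
  refine remnantAgeBound_of_exp (fun j A => ?_) (fun j A => ?_)
  · refine mul_nonneg (by norm_num) ?_
    obtain ⟨q, -⟩ := Finset.univ_nonempty (α := Q)
    exact le_trans (Finset.sum_nonneg fun x _ => abs_nonneg _)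
      (Finset.le_sup' (fun q => ∑ x ∈ through q, |locR (wF j) x - locR (wL j A) x|) (Finset.mem_univ q))
  · have hBk : 0 ≤ ce * p₀ * (A : ℝ) := mul_nonneg hce (Nat.cast_nonneg A)
    have hper : ∀ q : Q, ∑ x ∈ through q, |locR (wF j) x - locR (wL j A) x| ≤
        c * Real.exp (-(ce * p₀ * A)) * Cκ := by
      intro q
      calc ∑ x ∈ through q, |locR (wF j) x - locR (wL j A) x|
          ≤ ∑ x ∈ through q, c * Real.exp (-(ce * p₀ * A)) * Real.exp (-(κ * dk x)) :=
            Finset.sum_le_sum fun x _ => hexp (wF j) (wL j A) (pr j) _ hBk (hF j) (hL j A) (hmarked j A) x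
        _ = c * Real.exp (-(ce * p₀ * A)) * ∑ x ∈ through q, Real.exp (-(κ * dk x)) := by rw [Finset.mul_sum]
        _ ≤ c * Real.exp (-(ce * p₀ * A)) * Cκ :=
            mul_le_mul_of_nonneg_left (hcnt q) (mul_nonneg hc (Real.exp_pos _).le)
    have hsup : Finset.univ.sup' Finset.univ_nonempty
        (fun q => ∑ x ∈ through q, |locR (wF j) x - locR (wL j A) x|) ≤ c * Real.exp (-(ce * p₀ * A)) * Cκ :=
      Finset.sup'_le _ _ fun q _ => hper q
    calc 2 * Finset.univ.sup' Finset.univ_nonempty (fun q => ∑ x ∈ through q, |locR (wF j) x - locR (wL j A) x|)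
        ≤ 2 * (c * Real.exp (-(ce * p₀ * A)) * Cκ) := by linarith
      _ = 2 * c * Cκ * Real.exp (-(ce * p₀ * A)) := by ring

end Compose

end Summit.QuantumFields.BalabanUV.T4Continuum.WeightRoute
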